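import Summits.SmoothPoincare4.SmoothPoincare4.Theorems.CylinderEntropyCylinderRungTwoHeatSmoothingLargeTime
import Literature.Geometry.Riemannian.SphericalCylinderEntropy
import Literature.Geometry.Riemannian.SphericalCylinderEntropyZonalSmooth
import Literature.Analysis.PDE.PoissonKernelBall
import Mathlib.MeasureTheory.Measure.Hausdorff
import HarnessLib

/-!
# Route `CylinderEntropy`, crux `CylinderRungTwo` (stmt-SmoothPoincare4-7631), line `killing-flux`:
# the zonal heat smoothing on `S⁴` is `C²` in the centre, and its Laplace–Beltrami bracket
# (registered helper `helper_heatSmoothingContDiff`, step S3a of the area-quantization plan)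

For `t > 0` and a continuous `g : ℝ⁵ → ℝ`, the zonal smoothing

  `Q(w) = T_t g (w) = ∫_{S⁴} 𝔥(t, ⟨w, y⟩) g(y) dμH⁴(y)`,  `w ∈ ℝ⁵`,  `⟨w, y⟩ = ∑ᵢ wᵢ yᵢ`,

(`𝔥 = zonal`, the typed zonal heat kernel of `S⁴`, `= vol(S⁴) · H_{S⁴}` in the variable
`s = ⟨w, y⟩`; `S⁴ = Metric.sphere 0 1 ⊂ ℝ⁵`, `μH⁴` Mathlib's Hausdorff measure) is a smooth
function of the centre `w` on all of `ℝ⁵`, with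

  `DQ(w)(v)     = ∫_{S⁴} 𝔥'(t, s) ⟨v, y⟩ g(y)`,
  `D²Q(w)(a, b) = ∫_{S⁴} 𝔥''(t, s) ⟨a, y⟩ ⟨b, y⟩ g(y)`     (`s = ⟨w, y⟩`, `' = ∂_s`),

and therefore, since `∑_j yⱼ² = 1` on `S⁴` (the landed
`HeatSmoothingLargeTime.sum_sq_eq_one_of_mem_sphere` of the sibling S3c file, imported),

  `∑_{j<5} D²Q(w)(eⱼ, eⱼ) - D²Q(w)(w, w) - 4 DQ(w)(w)
      = ∫_{S⁴} ((1 - s²) 𝔥''(t, s) - 4 s 𝔥'(t, s)) g(y) dμH⁴(y)`.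

For `|w| = 1` the left-hand side is the Laplace–Beltrami operator of `S⁴` applied to `Q|_{S⁴}`
(`Δ_{S⁴} f = Δ_{ℝ⁵} f - D²f(n, n) - 4 ∂_n f` for the unit normal `n(w) = w`, mean curvature `4`),
and the right-hand side is `∂_t T_t g` by the zonal heat equation
`∂_τ 𝔥 = (1 - s²) ∂_s² 𝔥 - 4 s ∂_s 𝔥` (the registered sibling `helper_heatSmoothingTimeDeriv`,
not used here): together, `T_t g` solves the heat equation of `S⁴`.

The proof is differentiation under the integral sign for the SMOOTH kernel
`A(w, y) = 𝔥(t, ⟨w, y⟩)` on `ℝ⁵ × ℝ⁵` (`contDiff_zonal` of the tree composed with the bilinear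
pairing) against the finite measure `μH⁴⌊S⁴` (`hausdorffMeasure_sphere_four_lt_top`), in the
packaged form of the tree's `Literature.Analysis.PDE.contDiff_integral_kernel_mul_real` /
`fderiv_integral_kernel_mul_apply_real` (Dieudonné (8.11.2): `X ↦ ∫ A(X, m y) F(y) dν` is `C^∞`
with `D(∫ A F)(X) v = ∫ D A (X, m y)(v, 0) F y dν`, for `A` smooth, `m` a.e. bounded, `F ∈ L¹`),
applied once to `A` and once to the smooth kernel `q ↦ D A(q)(b, 0)`; the two kernel derivatives
are computed by the chain rule along the slices `w ↦ (w, y)`.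

* `HeatSmoothingContDiff.contDiff_zonalPairing`, `fderiv_zonalPairing_inl`,
  `fderiv_fderiv_zonalPairing_inl` — the kernel `(w, y) ↦ 𝔥(t, ⟨w, y⟩)` is `C^∞`, with
  `D A(w, y)(v, 0) = 𝔥'(t, s) ⟨v, y⟩` and `D[D A(·)(b, 0)](w, y)(a, 0) = 𝔥''(t, s) ⟨a, y⟩ ⟨b, y⟩`;
* `HeatSmoothingContDiff.integrable_sphere_of_continuous` — continuous functions are
  `μH⁴⌊S⁴`-integrable;
* `HeatSmoothingContDiff.contDiff_zonalSmoothing`, `fderiv_zonalSmoothing_apply`,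
  `iteratedFDeriv_two_zonalSmoothing`, `zonalSmoothing_bracket` — `Q ∈ C^∞(ℝ⁵)`, the two
  derivative formulas, and the bracket identity;
* `helper_heatSmoothingContDiff` — the registered helper, verbatim (`C²` and the bracket).

Everything here is PROVED (no `sorry`, no new definitions, no named facts).

References: R. S. Hamilton, *A matrix Harnack estimate for the heat equation*, Comm. Anal.
Geom. 1 (1993) 113–126, and *Monotonicity formulas for parabolic flows on manifolds*, ibid.
127–137, §4 (the heat kernel of the sphere); J. Dieudonné, *Foundations of Modern Analysis*
(1960), (8.11.2) (differentiation under the integral sign).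
-/

-- the prescribed namespace `Summit.SmoothPoincare4.SmoothPoincare4.…` repeats `SmoothPoincare4`
set_option linter.dupNamespace false

noncomputable section

open MeasureTheory Set Filter
open scoped Manifold ContDiff ENNReal NNReal Topology BigOperators

namespace Summit.SmoothPoincare4.SmoothPoincare4.Cruxes.CylinderRungTwo.KillingFlux

open Literature.Geometry.Riemannian
open Literature.Geometry.Riemannian.SphericalCylinderEntropy (zonal contDiff_zonal
  hausdorffMeasure_sphere_four_lt_top)

namespace HeatSmoothingContDiff

/-! ### The pairing `⟨w, y⟩ = ∑ᵢ wᵢ yᵢ` as a linear form in `w` -/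

/-- `w ↦ ⟨w, y⟩ = ∑ᵢ wᵢ yᵢ` is the continuous linear form `∑ᵢ yᵢ • projᵢ`. [folklore] -/
theorem pairing_eq_clm (y : EuclideanSpace ℝ (Fin 5)) :
    (fun w : EuclideanSpace ℝ (Fin 5) => ∑ i : Fin 5, w i * y i) =
      ⇑(∑ i : Fin 5, y i • (EuclideanSpace.proj i : EuclideanSpace ℝ (Fin 5) →L[ℝ] ℝ)) := by
  funext w
  simp [mul_comm]

/-- Evaluation of the linear form `∑ᵢ yᵢ • projᵢ`. [folklore] -/
theorem pairingCLM_apply (y v : EuclideanSpace ℝ (Fin 5)) :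
    (∑ i : Fin 5, y i • (EuclideanSpace.proj i : EuclideanSpace ℝ (Fin 5) →L[ℝ] ℝ)) v =
      ∑ i : Fin 5, v i * y i :=
  (congrFun (pairing_eq_clm y) v).symm

/-- The derivative of `w ↦ ⟨w, y⟩` is the linear form itself. [folklore] -/
theorem hasFDerivAt_pairing (y w : EuclideanSpace ℝ (Fin 5)) :
    HasFDerivAt (fun w' : EuclideanSpace ℝ (Fin 5) => ∑ i : Fin 5, w' i * y i)
      (∑ i : Fin 5, y i • (EuclideanSpace.proj i : EuclideanSpace ℝ (Fin 5) →L[ℝ] ℝ)) w := by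
  rw [pairing_eq_clm]
  exact ContinuousLinearMap.hasFDerivAt _

/-- `⟨eⱼ, y⟩ = yⱼ` for the coordinate frame `eⱼ = EuclideanSpace.single j 1`. [folklore] -/
theorem pairing_single_left (j : Fin 5) (y : EuclideanSpace ℝ (Fin 5)) :
    ∑ i : Fin 5, (EuclideanSpace.single j (1 : ℝ) : EuclideanSpace ℝ (Fin 5)) i * y i = y j := by
  simp

/-! ### The smooth kernel `A(w, y) = 𝔥(t, ⟨w, y⟩)` on `ℝ⁵ × ℝ⁵` and its slice derivatives -/

/-- **The kernel `(w, y) ↦ 𝔥(t, ⟨w, y⟩)` is `C^∞` on `ℝ⁵ × ℝ⁵`** for `t > 0` (`contDiff_zonal`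
composed with the bilinear pairing). [folklore] -/
theorem contDiff_zonalPairing {t : ℝ} (ht : 0 < t) :
    ContDiff ℝ ∞ (fun p : EuclideanSpace ℝ (Fin 5) × EuclideanSpace ℝ (Fin 5) =>
      zonal t (∑ i : Fin 5, p.1 i * p.2 i)) :=
  (contDiff_zonal ht).comp (by fun_prop)

/-- `∂_s 𝔥(t, ·)` is smooth for `t > 0`. [folklore] -/
theorem contDiff_deriv_zonal {t : ℝ} (ht : 0 < t) : ContDiff ℝ ∞ (deriv (zonal t)) :=
  (contDiff_infty_iff_deriv.1 (contDiff_zonal ht)).2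

/-- `∂_s² 𝔥(t, ·)` is smooth for `t > 0`. [folklore] -/
theorem contDiff_deriv_deriv_zonal {t : ℝ} (ht : 0 < t) :
    ContDiff ℝ ∞ (deriv (deriv (zonal t))) :=
  (contDiff_infty_iff_deriv.1 (contDiff_deriv_zonal ht)).2

/-- `∂_s 𝔥(t, ·)` is continuous for `t > 0`. [folklore] -/
theorem continuous_deriv_zonal {t : ℝ} (ht : 0 < t) : Continuous (deriv (zonal t)) :=
  (contDiff_deriv_zonal ht).continuous

/-- `∂_s² 𝔥(t, ·)` is continuous for `t > 0`. [folklore] -/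
theorem continuous_deriv_deriv_zonal {t : ℝ} (ht : 0 < t) :
    Continuous (deriv (deriv (zonal t))) :=
  (contDiff_deriv_deriv_zonal ht).continuous

/-- **First slice derivative of the kernel**: `D A(w, y)(v, 0) = 𝔥'(t, ⟨w, y⟩) ⟨v, y⟩` for
`A(w, y) = 𝔥(t, ⟨w, y⟩)` (chain rule along `w ↦ (w, y)`). [folklore] -/
theorem fderiv_zonalPairing_inl {t : ℝ} (ht : 0 < t) (w y v : EuclideanSpace ℝ (Fin 5)) :
    fderiv ℝ (fun p : EuclideanSpace ℝ (Fin 5) × EuclideanSpace ℝ (Fin 5) =>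
        zonal t (∑ i : Fin 5, p.1 i * p.2 i)) (w, y) (v, 0) =
      deriv (zonal t) (∑ i : Fin 5, w i * y i) * ∑ i : Fin 5, v i * y i := by
  have hA := contDiff_zonalPairing ht
  have hAd : HasFDerivAt
      (fun p : EuclideanSpace ℝ (Fin 5) × EuclideanSpace ℝ (Fin 5) =>
        zonal t (∑ i : Fin 5, p.1 i * p.2 i))
      (fderiv ℝ (fun p : EuclideanSpace ℝ (Fin 5) × EuclideanSpace ℝ (Fin 5) =>
        zonal t (∑ i : Fin 5, p.1 i * p.2 i)) (w, y)) (w, y) :=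
    ((hA.differentiable (by simp)) (w, y)).hasFDerivAt
  -- `h1 : HasFDerivAt (A ∘ (·, y)) (D A(w, y) ∘ inl) w`
  have h1 := hAd.comp w (hasFDerivAt_prodMk_left (𝕜 := ℝ) w y)
  have h2 : HasFDerivAt (fun w' : EuclideanSpace ℝ (Fin 5) => zonal t (∑ i : Fin 5, w' i * y i))
      (deriv (zonal t) (∑ i : Fin 5, w i * y i) •
        (∑ i : Fin 5, y i • (EuclideanSpace.proj i : EuclideanSpace ℝ (Fin 5) →L[ℝ] ℝ))) w := by
    have hz : HasDerivAt (zonal t) (deriv (zonal t) (∑ i : Fin 5, w i * y i))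
        (∑ i : Fin 5, w i * y i) :=
      (((contDiff_zonal ht).differentiable (by simp)) _).hasDerivAt
    exact hz.comp_hasFDerivAt w (hasFDerivAt_pairing y w)
  have h3 := congrArg (fun L : EuclideanSpace ℝ (Fin 5) →L[ℝ] ℝ => L v) (h1.unique h2)
  simpa only [ContinuousLinearMap.comp_apply, ContinuousLinearMap.inl_apply,
    FunLike.coe_smul, Pi.smul_apply, pairingCLM_apply, smul_eq_mul] using h3

/-- **Second slice derivative of the kernel**:
`D[q ↦ D A(q)(b, 0)](w, y)(a, 0) = 𝔥''(t, ⟨w, y⟩) ⟨a, y⟩ ⟨b, y⟩` for `A(w, y) = 𝔥(t, ⟨w, y⟩)`.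
[folklore] -/
theorem fderiv_fderiv_zonalPairing_inl {t : ℝ} (ht : 0 < t) (w y a b : EuclideanSpace ℝ (Fin 5)) :
    fderiv ℝ (fun q : EuclideanSpace ℝ (Fin 5) × EuclideanSpace ℝ (Fin 5) =>
        fderiv ℝ (fun p : EuclideanSpace ℝ (Fin 5) × EuclideanSpace ℝ (Fin 5) =>
          zonal t (∑ i : Fin 5, p.1 i * p.2 i)) q (b, 0)) (w, y) (a, 0) =
      deriv (deriv (zonal t)) (∑ i : Fin 5, w i * y i) * (∑ i : Fin 5, a i * y i) *
        ∑ i : Fin 5, b i * y i := by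
  have hA := contDiff_zonalPairing ht
  have hA1 : ContDiff ℝ ∞ fun q : EuclideanSpace ℝ (Fin 5) × EuclideanSpace ℝ (Fin 5) =>
      fderiv ℝ (fun p : EuclideanSpace ℝ (Fin 5) × EuclideanSpace ℝ (Fin 5) =>
        zonal t (∑ i : Fin 5, p.1 i * p.2 i)) q (b, 0) :=
    (hA.fderiv_right le_rfl).clm_apply contDiff_const
  have hAd : HasFDerivAt
      (fun q : EuclideanSpace ℝ (Fin 5) × EuclideanSpace ℝ (Fin 5) =>
        fderiv ℝ (fun p : EuclideanSpace ℝ (Fin 5) × EuclideanSpace ℝ (Fin 5) =>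
          zonal t (∑ i : Fin 5, p.1 i * p.2 i)) q (b, 0))
      (fderiv ℝ (fun q : EuclideanSpace ℝ (Fin 5) × EuclideanSpace ℝ (Fin 5) =>
        fderiv ℝ (fun p : EuclideanSpace ℝ (Fin 5) × EuclideanSpace ℝ (Fin 5) =>
          zonal t (∑ i : Fin 5, p.1 i * p.2 i)) q (b, 0)) (w, y)) (w, y) :=
    ((hA1.differentiable (by simp)) (w, y)).hasFDerivAt
  -- `h1 : HasFDerivAt ((D A(·)(b, 0)) ∘ (·, y)) (D[D A(·)(b, 0)](w, y) ∘ inl) w`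
  have h1 := hAd.comp w (hasFDerivAt_prodMk_left (𝕜 := ℝ) w y)
  have hfun : (fun w' : EuclideanSpace ℝ (Fin 5) =>
      fderiv ℝ (fun p : EuclideanSpace ℝ (Fin 5) × EuclideanSpace ℝ (Fin 5) =>
        zonal t (∑ i : Fin 5, p.1 i * p.2 i)) (w', y) (b, 0)) =
      fun w' : EuclideanSpace ℝ (Fin 5) =>
        deriv (zonal t) (∑ i : Fin 5, w' i * y i) * ∑ i : Fin 5, b i * y i :=
    funext fun w' => fderiv_zonalPairing_inl ht w' y b
  have h2 : HasFDerivAt (fun w' : EuclideanSpace ℝ (Fin 5) =>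
      fderiv ℝ (fun p : EuclideanSpace ℝ (Fin 5) × EuclideanSpace ℝ (Fin 5) =>
        zonal t (∑ i : Fin 5, p.1 i * p.2 i)) (w', y) (b, 0))
      ((∑ i : Fin 5, b i * y i) • (deriv (deriv (zonal t)) (∑ i : Fin 5, w i * y i) •
        (∑ i : Fin 5, y i • (EuclideanSpace.proj i : EuclideanSpace ℝ (Fin 5) →L[ℝ] ℝ)))) w := by
    have hz : HasDerivAt (deriv (zonal t)) (deriv (deriv (zonal t)) (∑ i : Fin 5, w i * y i))
        (∑ i : Fin 5, w i * y i) :=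
      (((contDiff_deriv_zonal ht).differentiable (by simp)) _).hasDerivAt
    rw [hfun]
    exact (hz.comp_hasFDerivAt w (hasFDerivAt_pairing y w)).mul_const _
  have h3 := congrArg (fun L : EuclideanSpace ℝ (Fin 5) →L[ℝ] ℝ => L a) (h1.unique h2)
  simp only [ContinuousLinearMap.comp_apply, ContinuousLinearMap.inl_apply,
    FunLike.coe_smul, Pi.smul_apply, pairingCLM_apply, smul_eq_mul] at h3
  rw [h3]
  ring

/-! ### The finite measure `μH⁴⌊S⁴` -/

/-- `μH⁴⌊S⁴`-almost every point has norm `≤ 1`. [folklore] -/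
theorem ae_norm_le_one_sphere :
    ∀ᵐ y ∂((μH[4] : Measure (EuclideanSpace ℝ (Fin 5))).restrict
      (Metric.sphere (0 : EuclideanSpace ℝ (Fin 5)) 1)), ‖y‖ ≤ (1 : ℝ) :=
  (ae_restrict_mem Metric.isClosed_sphere.measurableSet).mono fun _ hy =>
    (mem_sphere_zero_iff_norm.1 hy).le

/-- **A continuous function is `μH⁴⌊S⁴`-integrable** (bounded on the compact sphere, which has
finite `μH⁴`-measure by `hausdorffMeasure_sphere_four_lt_top`). [folklore] -/
theorem integrable_sphere_of_continuous {f : EuclideanSpace ℝ (Fin 5) → ℝ} (hf : Continuous f) :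
    Integrable f ((μH[4] : Measure (EuclideanSpace ℝ (Fin 5))).restrict
      (Metric.sphere (0 : EuclideanSpace ℝ (Fin 5)) 1)) := by
  obtain ⟨C, hC⟩ := (isCompact_sphere (0 : EuclideanSpace ℝ (Fin 5)) 1).exists_bound_of_continuousOn
    hf.continuousOn
  exact Measure.integrableOn_of_bounded hausdorffMeasure_sphere_four_lt_top.ne
    hf.aestronglyMeasurable
    ((ae_restrict_mem Metric.isClosed_sphere.measurableSet).mono fun y hy => hC y hy)

/-! ### The zonal smoothing `Q(w) = ∫_{S⁴} 𝔥(t, ⟨w, y⟩) g(y) dμH⁴(y)` -/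

/-- **The zonal smoothing is `C^∞` in the centre**: for `t > 0` and continuous `g`,
`w ↦ ∫_{S⁴} 𝔥(t, ⟨w, y⟩) g(y) dμH⁴(y)` is smooth on `ℝ⁵` (the tree's
`contDiff_integral_kernel_mul_real` for the smooth kernel `𝔥(t, ⟨·, ·⟩)`, `m = id` bounded by `1`
a.e. on the sphere, `F = g ∈ L¹(μH⁴⌊S⁴)`). [folklore] -/
theorem contDiff_zonalSmoothing {t : ℝ} (ht : 0 < t) {g : EuclideanSpace ℝ (Fin 5) → ℝ}
    (hg : Continuous g) :
    ContDiff ℝ ∞ (fun w : EuclideanSpace ℝ (Fin 5) =>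
      ∫ y in Metric.sphere (0 : EuclideanSpace ℝ (Fin 5)) 1, zonal t (∑ i : Fin 5, w i * y i) * g y
        ∂(μH[4] : Measure (EuclideanSpace ℝ (Fin 5)))) :=
  Literature.Analysis.PDE.contDiff_integral_kernel_mul_real (contDiff_zonalPairing ht)
    (m := fun y : EuclideanSpace ℝ (Fin 5) => y) aestronglyMeasurable_id ae_norm_le_one_sphere
    (integrable_sphere_of_continuous hg)

/-- **First derivative of the zonal smoothing**:
`DQ(w)(v) = ∫_{S⁴} 𝔥'(t, ⟨w, y⟩) ⟨v, y⟩ g(y) dμH⁴(y)`. [folklore] -/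
theorem fderiv_zonalSmoothing_apply {t : ℝ} (ht : 0 < t) {g : EuclideanSpace ℝ (Fin 5) → ℝ}
    (hg : Continuous g) (w v : EuclideanSpace ℝ (Fin 5)) :
    fderiv ℝ (fun w' : EuclideanSpace ℝ (Fin 5) =>
      ∫ y in Metric.sphere (0 : EuclideanSpace ℝ (Fin 5)) 1, zonal t (∑ i : Fin 5, w' i * y i) * g y
        ∂(μH[4] : Measure (EuclideanSpace ℝ (Fin 5)))) w v =
      ∫ y in Metric.sphere (0 : EuclideanSpace ℝ (Fin 5)) 1,
        deriv (zonal t) (∑ i : Fin 5, w i * y i) * (∑ i : Fin 5, v i * y i) * g y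
        ∂(μH[4] : Measure (EuclideanSpace ℝ (Fin 5))) := by
  refine (Literature.Analysis.PDE.fderiv_integral_kernel_mul_apply_real (contDiff_zonalPairing ht)
    (m := fun y : EuclideanSpace ℝ (Fin 5) => y) aestronglyMeasurable_id ae_norm_le_one_sphere
    (integrable_sphere_of_continuous hg) w v).trans ?_
  refine integral_congr_ae (Eventually.of_forall fun y => ?_)
  simp only [fderiv_zonalPairing_inl ht]

/-- **Second derivative of the zonal smoothing**:
`D²Q(w)(a, b) = ∫_{S⁴} 𝔥''(t, ⟨w, y⟩) ⟨a, y⟩ ⟨b, y⟩ g(y) dμH⁴(y)` (`iteratedFDeriv ℝ 2` on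
`![a, b]`; `D²Q(w)(a, b) = D[w ↦ DQ(w)(b)](a)`, and `w ↦ DQ(w)(b)` is again a smooth-kernel
integral, with kernel `q ↦ D A(q)(b, 0)`). [folklore] -/
theorem iteratedFDeriv_two_zonalSmoothing {t : ℝ} (ht : 0 < t) {g : EuclideanSpace ℝ (Fin 5) → ℝ}
    (hg : Continuous g) (w a b : EuclideanSpace ℝ (Fin 5)) :
    iteratedFDeriv ℝ 2 (fun w' : EuclideanSpace ℝ (Fin 5) =>
      ∫ y in Metric.sphere (0 : EuclideanSpace ℝ (Fin 5)) 1, zonal t (∑ i : Fin 5, w' i * y i) * g y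
        ∂(μH[4] : Measure (EuclideanSpace ℝ (Fin 5)))) w ![a, b] =
      ∫ y in Metric.sphere (0 : EuclideanSpace ℝ (Fin 5)) 1,
        deriv (deriv (zonal t)) (∑ i : Fin 5, w i * y i) * (∑ i : Fin 5, a i * y i) *
          (∑ i : Fin 5, b i * y i) * g y ∂(μH[4] : Measure (EuclideanSpace ℝ (Fin 5))) := by
  set Q := fun w' : EuclideanSpace ℝ (Fin 5) =>
    ∫ y in Metric.sphere (0 : EuclideanSpace ℝ (Fin 5)) 1, zonal t (∑ i : Fin 5, w' i * y i) * g y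
      ∂(μH[4] : Measure (EuclideanSpace ℝ (Fin 5))) with hQdef
  have hQ : ContDiff ℝ ∞ Q := contDiff_zonalSmoothing ht hg
  have hA1 : ContDiff ℝ ∞ fun q : EuclideanSpace ℝ (Fin 5) × EuclideanSpace ℝ (Fin 5) =>
      fderiv ℝ (fun p : EuclideanSpace ℝ (Fin 5) × EuclideanSpace ℝ (Fin 5) =>
        zonal t (∑ i : Fin 5, p.1 i * p.2 i)) q (b, 0) :=
    ((contDiff_zonalPairing ht).fderiv_right le_rfl).clm_apply contDiff_const
  rw [iteratedFDeriv_two_apply]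
  simp only [Matrix.cons_val_zero, Matrix.cons_val_one]
  -- `D²Q(w)(a)(b) = D[w ↦ DQ(w)(b)](w)(a)`
  have hd : DifferentiableAt ℝ (fderiv ℝ Q) w :=
    ((hQ.fderiv_right (m := ∞) le_rfl).differentiable (by simp)) w
  have hswap : fderiv ℝ (fun X : EuclideanSpace ℝ (Fin 5) => fderiv ℝ Q X b) w a =
      fderiv ℝ (fderiv ℝ Q) w a b := by
    rw [fderiv_clm_apply hd (differentiableAt_const b)]
    simp
  rw [← hswap]
  -- `w ↦ DQ(w)(b)` is the smooth-kernel integral with kernel `q ↦ D A(q)(b, 0)`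
  have hfun : (fun X : EuclideanSpace ℝ (Fin 5) => fderiv ℝ Q X b) =
      fun X : EuclideanSpace ℝ (Fin 5) =>
        ∫ y, (fun q : EuclideanSpace ℝ (Fin 5) × EuclideanSpace ℝ (Fin 5) =>
          fderiv ℝ (fun p : EuclideanSpace ℝ (Fin 5) × EuclideanSpace ℝ (Fin 5) =>
            zonal t (∑ i : Fin 5, p.1 i * p.2 i)) q (b, 0))
          (X, (fun y : EuclideanSpace ℝ (Fin 5) => y) y) * g y
        ∂((μH[4] : Measure (EuclideanSpace ℝ (Fin 5))).restrict
          (Metric.sphere (0 : EuclideanSpace ℝ (Fin 5)) 1)) := by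
    funext X
    exact Literature.Analysis.PDE.fderiv_integral_kernel_mul_apply_real (contDiff_zonalPairing ht)
      (m := fun y : EuclideanSpace ℝ (Fin 5) => y) aestronglyMeasurable_id ae_norm_le_one_sphere
      (integrable_sphere_of_continuous hg) X b
  rw [hfun]
  refine (Literature.Analysis.PDE.fderiv_integral_kernel_mul_apply_real hA1
    (m := fun y : EuclideanSpace ℝ (Fin 5) => y) aestronglyMeasurable_id ae_norm_le_one_sphere
    (integrable_sphere_of_continuous hg) w a).trans ?_
  refine integral_congr_ae (Eventually.of_forall fun y => ?_)
  simp only [fderiv_fderiv_zonalPairing_inl ht]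

/-- **The Laplace–Beltrami bracket of the zonal smoothing**: for every `w ∈ ℝ⁵`,
`∑_{j<5} D²Q(w)(eⱼ, eⱼ) - D²Q(w)(w, w) - 4 DQ(w)(w)
  = ∫_{S⁴} ((1 - s²) 𝔥''(t, s) - 4 s 𝔥'(t, s)) g(y) dμH⁴(y)`, `s = ⟨w, y⟩`
(the three derivative integrals combined under one integral sign; pointwise on the sphere
`∑_j 𝔥'' yⱼ² = 𝔥''` because `∑_j yⱼ² = 1`).  For `|w| = 1` the left-hand side is `Δ_{S⁴} Q (w)`.
[folklore] -/
theorem zonalSmoothing_bracket {t : ℝ} (ht : 0 < t) {g : EuclideanSpace ℝ (Fin 5) → ℝ}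
    (hg : Continuous g) (w : EuclideanSpace ℝ (Fin 5)) :
    (∑ j : Fin 5, iteratedFDeriv ℝ 2 (fun w' : EuclideanSpace ℝ (Fin 5) =>
        ∫ y in Metric.sphere (0 : EuclideanSpace ℝ (Fin 5)) 1, zonal t (∑ i : Fin 5, w' i * y i) * g y
          ∂(μH[4] : Measure (EuclideanSpace ℝ (Fin 5)))) w
        ![EuclideanSpace.single j (1 : ℝ), EuclideanSpace.single j (1 : ℝ)])
      - iteratedFDeriv ℝ 2 (fun w' : EuclideanSpace ℝ (Fin 5) =>
        ∫ y in Metric.sphere (0 : EuclideanSpace ℝ (Fin 5)) 1, zonal t (∑ i : Fin 5, w' i * y i) * g y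
          ∂(μH[4] : Measure (EuclideanSpace ℝ (Fin 5)))) w ![w, w]
      - 4 * fderiv ℝ (fun w' : EuclideanSpace ℝ (Fin 5) =>
        ∫ y in Metric.sphere (0 : EuclideanSpace ℝ (Fin 5)) 1, zonal t (∑ i : Fin 5, w' i * y i) * g y
          ∂(μH[4] : Measure (EuclideanSpace ℝ (Fin 5)))) w w =
      ∫ y in Metric.sphere (0 : EuclideanSpace ℝ (Fin 5)) 1,
        ((1 - (∑ i : Fin 5, w i * y i) ^ 2) * deriv (deriv (zonal t)) (∑ i : Fin 5, w i * y i) -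
          4 * (∑ i : Fin 5, w i * y i) * deriv (zonal t) (∑ i : Fin 5, w i * y i)) * g y
        ∂(μH[4] : Measure (EuclideanSpace ℝ (Fin 5))) := by
  have hc1 := continuous_deriv_zonal ht
  have hc2 := continuous_deriv_deriv_zonal ht
  simp only [iteratedFDeriv_two_zonalSmoothing ht hg, fderiv_zonalSmoothing_apply ht hg,
    pairing_single_left]
  -- integrability of the three (continuous) integrands on the finite measure `μH⁴⌊S⁴`
  have hI : ∀ j : Fin 5, Integrable (fun y : EuclideanSpace ℝ (Fin 5) =>
      deriv (deriv (zonal t)) (∑ i : Fin 5, w i * y i) * y j * y j * g y)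
      ((μH[4] : Measure (EuclideanSpace ℝ (Fin 5))).restrict
        (Metric.sphere (0 : EuclideanSpace ℝ (Fin 5)) 1)) := fun j =>
    integrable_sphere_of_continuous (by fun_prop)
  have hW : Integrable (fun y : EuclideanSpace ℝ (Fin 5) =>
      deriv (deriv (zonal t)) (∑ i : Fin 5, w i * y i) * (∑ i : Fin 5, w i * y i) *
        (∑ i : Fin 5, w i * y i) * g y)
      ((μH[4] : Measure (EuclideanSpace ℝ (Fin 5))).restrict
        (Metric.sphere (0 : EuclideanSpace ℝ (Fin 5)) 1)) :=
    integrable_sphere_of_continuous (by fun_prop)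
  have hV : Integrable (fun y : EuclideanSpace ℝ (Fin 5) =>
      4 * (deriv (zonal t) (∑ i : Fin 5, w i * y i) * (∑ i : Fin 5, w i * y i) * g y))
      ((μH[4] : Measure (EuclideanSpace ℝ (Fin 5))).restrict
        (Metric.sphere (0 : EuclideanSpace ℝ (Fin 5)) 1)) :=
    integrable_sphere_of_continuous (by fun_prop)
  have hFW : Integrable (fun y : EuclideanSpace ℝ (Fin 5) =>
      (∑ j : Fin 5, deriv (deriv (zonal t)) (∑ i : Fin 5, w i * y i) * y j * y j * g y) -
        deriv (deriv (zonal t)) (∑ i : Fin 5, w i * y i) * (∑ i : Fin 5, w i * y i) *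
          (∑ i : Fin 5, w i * y i) * g y)
      ((μH[4] : Measure (EuclideanSpace ℝ (Fin 5))).restrict
        (Metric.sphere (0 : EuclideanSpace ℝ (Fin 5)) 1)) :=
    (integrable_finsetSum _ fun j _ => hI j).sub hW
  rw [← integral_finsetSum _ fun j _ => hI j, ← integral_const_mul,
    ← integral_sub (integrable_finsetSum _ fun j _ => hI j) hW, ← integral_sub hFW hV]
  -- pointwise on the sphere
  refine setIntegral_congr_fun Metric.isClosed_sphere.measurableSet fun y hy => ?_
  have hsum : ∑ j : Fin 5, deriv (deriv (zonal t)) (∑ i : Fin 5, w i * y i) * y j * y j * g y =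
      deriv (deriv (zonal t)) (∑ i : Fin 5, w i * y i) * g y := by
    calc _ = deriv (deriv (zonal t)) (∑ i : Fin 5, w i * y i) * g y * ∑ j : Fin 5, y j ^ 2 := by
          rw [Finset.mul_sum]
          exact Finset.sum_congr rfl fun j _ => by ring
      _ = _ := by rw [HeatSmoothingLargeTime.sum_sq_eq_one_of_mem_sphere hy, mul_one]
  rw [hsum]
  ring

end HeatSmoothingContDiff

open HeatSmoothingContDiff

/-- **Registered helper `helper_heatSmoothingContDiff` of line `killing-flux` (step S3a of the
area-quantization plan: the heat semigroup of `S⁴` built from the typed zonal kernel — smoothness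
in space and the Laplace–Beltrami bracket).** For `t > 0` and continuous `g : ℝ⁵ → ℝ`, with
`𝔥 = zonal`, `s = ∑ᵢ wᵢ yᵢ` and `Q(w) = ∫_{S⁴} 𝔥(t, s) g(y) dμH⁴(y)` (`w ∈ ℝ⁵`):
(1) `Q ∈ C²(ℝ⁵)` (indeed `C^∞`, `contDiff_zonalSmoothing`); (2) for every `w ∈ ℝ⁵`,
`∑_{j<5} D²Q(w)(eⱼ, eⱼ) - D²Q(w)(w, w) - 4 DQ(w)(w)
  = ∫_{S⁴} ((1 - s²) 𝔥''(t, s) - 4 s 𝔥'(t, s)) g(y) dμH⁴(y)` (`zonalSmoothing_bracket`; for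
`|w| = 1` the left-hand side is `Δ_{S⁴} Q (w)` and the right-hand side is `∂_t Q` by the zonal
heat equation). [folklore] -/
theorem helper_heatSmoothingContDiff : ∀ t : ℝ, 0 < t → ∀ g : EuclideanSpace ℝ (Fin 5) → ℝ, Continuous g → ContDiff ℝ 2 (fun w : EuclideanSpace ℝ (Fin 5) => ∫ y in Metric.sphere (0 : EuclideanSpace ℝ (Fin 5)) 1, Literature.Geometry.Riemannian.SphericalCylinderEntropy.zonal t (∑ i : Fin 5, w i * y i) * g y ∂(μH[4] : Measure (EuclideanSpace ℝ (Fin 5)))) ∧ ∀ w : EuclideanSpace ℝ (Fin 5), (∑ j : Fin 5, iteratedFDeriv ℝ 2 (fun w' : EuclideanSpace ℝ (Fin 5) => ∫ y in Metric.sphere (0 : EuclideanSpace ℝ (Fin 5)) 1, Literature.Geometry.Riemannian.SphericalCylinderEntropy.zonal t (∑ i : Fin 5, w' i * y i) * g y ∂(μH[4] : Measure (EuclideanSpace ℝ (Fin 5)))) w ![EuclideanSpace.single j (1 : ℝ), EuclideanSpace.single j (1 : ℝ)]) - iteratedFDeriv ℝ 2 (fun w' : EuclideanSpace ℝ (Fin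 5) => ∫ y in Metric.sphere (0 : EuclideanSpace ℝ (Fin 5)) 1, Literature.Geometry.Riemannian.SphericalCylinderEntropy.zonal t (∑ i : Fin 5, w' i * y i) * g y ∂(μH[4] : Measure (EuclideanSpace ℝ (Fin 5)))) w ![w, w] - 4 * fderiv ℝ (fun w' : EuclideanSpace ℝ (Fin 5) => ∫ y in Metric.sphere (0 : EuclideanSpace ℝ (Fin 5)) 1, Literature.Geometry.Riemannian.SphericalCylinderEntropy.zonal t (∑ i : Fin 5, w' i * y i) * g y ∂(μH[4] : Measure (EuclideanSpace ℝ (Fin 5)))) w w = ∫ y in Metric.sphere (0 : EuclideanSpace ℝ (Fin 5)) 1, ((1 - (∑ i : Fin 5, w i * y i) ^ 2) * deriv (deriv (Literature.Geometry.Riemannian.SphericalCylinderEntropy.zonal t)) (∑ i : Fin 5, w i * y i) - 4 * (∑ i : Fin 5, w i * y i) * deriv (Literature.Geometry.Riemannian.SphericalCylinderEntropy.zonal t) (∑ i : Fin 5, w i * y i)) * g y ∂(μH[4] : Measure (EuclideanSpace ℝ (Fin 5))) :=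
  fun _ ht _ hg => ⟨contDiff_infty.1 (contDiff_zonalSmoothing ht hg) 2,
    fun w => zonalSmoothing_bracket ht hg w⟩

end Summit.SmoothPoincare4.SmoothPoincare4.Cruxes.CylinderRungTwo.KillingFlux

end
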